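import Mathlib
import HarnessLib
import Literature.Analysis.FluidPDE.Tao2016AveragedNS.ViscousEnvelopeSmoothing
import Summits.NavierStokesRegularity.NavierStokesRegularity.Theorems.WakeRatchetMinimalViscousBlowupEnergyBudget
import Summits.NavierStokesRegularity.NavierStokesRegularity.Theorems.WakeRatchetMinimalViscousBlowupRestartEnvelope
import Summits.NavierStokesRegularity.NavierStokesRegularity.Theorems.WakeRatchetMinimalViscousBlowupViscosityBootstrap

/-!
# Route `WakeRatchet`, crux `MinimalViscousBlowup` (stmt-NavierStokesRegularity-22743) — LINE g11-1 «threshold ray» (ns-idea-1 g11),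
# stub S2 `stub_regularOpen`: THE SET OF REGULAR VISCOSITIES IS OPEN

`regularOpen` (binders VERBATIM from the skeleton of record `threshold_ray_line_v22.lean`, statement unchanged in v2.3): for `ε₀ > 0`, a table of
the class `E₂(R)`, a one-shell datum `X₀` and `ν > 0` admitting a global regular `ν`-viscous solution `X`, every `ν'` close to `ν` admits one.
A PRIORI ROUTE (STUB-PLAN-regularOpen.md): with `A = ν/(1024λ²)` (so `32·4²·λ²·A = ν/2 ≤ ν'`),
* (E1) `exists_small_weightOne_time`: a time `t₁ ≥ 0` with `λ^k|X_{i,k}(t₁)| ≤ A/4`;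
* (E2) `weighted_continuity`: for `|ν'−ν| < δ(ν, λ, M, t₁)` every regular `ν'`-solution `X'` on a window `[0,s]` stays `η λ^{−8k⁺}`-close to `X`
  on `[0, min(s,t₁)]` (`η = min(1, A/4)`), whence the envelope `(M+1)λ^{−k}` there (`M` the (4.5) bound of `X` on `[0,t₁+1]`);
* (E3) `envelope_from_time`: `|X'(t₁)| ≤ (A/2)λ^{−k}` restarts the dissipation bootstrap, envelope `Aλ^{−k}` on `[t₁,s]`;
* `tailEnergy_le_of_envelope` turns the envelope `max(M+1,A)λ^{−k}` into the subcritical tail-energy bound (`η = 1`) uniformly over all windows,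
  and `exists_viscousGlobal_of_subcriticalEnvelope_of_inTableClass` concludes.
MODEL lattice ODEs only; nothing here concerns the Navier–Stokes equations (no NS regularity statement is proved).
`--supports stmt-NavierStokesRegularity-22743 --as helper`.
[cite: Tao2016AveragedNS, §4 (viscous equation before Thm. 4.2), Lemma 4.1 (4.5), proof of (4.13); BarbatoMorandinRomito2011, §3.1 Prop. 3.3, §3.2;
Teschl2012, Thm. 2.8]
-/

noncomputable section

-- the summit and its single sub-problem share the name (CONVENTIONS §1)
set_option linter.dupNamespace false

open Set Filter Topology

namespace Summit.NavierStokesRegularity.NavierStokesRegularity.Theorems.MinimalViscousBlowup.ThresholdRay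

open Literature.Analysis.FluidPDE Literature.Analysis.FluidPDE.TaoCascade

/-- **S2 `stub_regularOpen` (LINE g11-1 v2.2/v2.3, binders VERBATIM) — THE SET OF REGULAR VISCOSITIES IS OPEN.**  For `ε₀ > 0`, a table of the
class `E₂(R)`, a one-shell datum and `ν > 0` with a global regular solution of the NS-scaled `ν`-viscous cascade lattice, there is `δ > 0` such
that every `ν' > 0` with `|ν' − ν| < δ` has a global regular solution from the same datum (energy budget + continuity in `ν` on a compact
window + small-data restart + envelope continuation).  MODEL lattice only.
[cite: Tao2016AveragedNS, §4 Lemma 4.1 (4.5) and proof of (4.13); BarbatoMorandinRomito2011, §3.1 Prop. 3.3; Teschl2012, Thm. 2.8] -/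
theorem regularOpen : ∀ ε₀ : ℝ, 0 < ε₀ → ∀ R : ℝ, 1 ≤ R →
    ∀ (α : Fin 4 → Fin 4 → Fin 4 → ℤ × ℤ × ℤ → ℝ) (X₀ : Fin 4 → ℝ),
    Literature.Analysis.FluidPDE.TaoCascade.InTableClass R α →
    ∀ ν : ℝ, 0 < ν →
    (∃ X : Fin 4 → ℤ → ℝ → ℝ, Literature.Analysis.FluidPDE.TaoCascade.ViscousGlobal ε₀ ν α X₀ X) →
    ∃ δ : ℝ, 0 < δ ∧ ∀ ν' : ℝ, 0 < ν' → |ν' - ν| < δ →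
      ∃ X' : Fin 4 → ℤ → ℝ → ℝ, Literature.Analysis.FluidPDE.TaoCascade.ViscousGlobal ε₀ ν' α X₀ X' := by
  intro ε₀ hε R _hR α X₀ hα ν hν hex
  obtain ⟨X, hX⟩ := hex
  have hl0 : (0 : ℝ) < 1 + ε₀ := by linarith
  have hl1 : (1 : ℝ) < 1 + ε₀ := by linarith
  have hpow : ∀ a : ℝ, 0 < (1 + ε₀) ^ a := fun a => Real.rpow_pos_of_pos hl0 a
  -- the restricted table is bounded by `1` and drives the same nonlinearity
  have hα' : ∀ i₁ i₂ i₃ μ, |restrictShiftSet α i₁ i₂ i₃ μ| ≤ 1 :=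
    abs_restrictShiftSet_le zero_le_one (abs_le_one_of_inTableClass hα)
  -- the restart amplitude `A`, `32·4²·λ²·A = ν/2`
  set A : ℝ := ν / (1024 * (1 + ε₀) ^ (2 : ℝ)) with hA
  have hA0 : 0 < A := by rw [hA]; positivity
  have hAν : 32 * ((4 : ℕ) : ℝ) ^ 2 * 1 * (1 + ε₀) ^ (2 : ℝ) * A = ν / 2 := by
    have h2 : (1 + ε₀) ^ (2 : ℝ) ≠ 0 := (hpow 2).ne'
    rw [hA]
    field_simp
    norm_num
  -- (E1) a time of small weight-one energy for `X`
  obtain ⟨t₁, ht₁, -, hθ⟩ := exists_small_weightOne_time hε hν hα hX (θ := A / 4) (by positivity)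
  -- the (4.5) bound of `X` on `[0, t₁ + 1]`
  obtain ⟨M₀, hM₀⟩ := hX.apriori (t₁ + 1) (by linarith)
  set M : ℝ := max M₀ 0 with hMdef
  have hM0 : 0 ≤ M := le_max_right _ _
  have hM : ∀ t ∈ Icc (0 : ℝ) (t₁ + 1), ∀ (i : Fin 4) (k : ℤ), (1 + (1 + ε₀) ^ ((10 : ℝ) * k)) * |X i k t| ≤ M :=
    fun t ht i k => (hM₀ t ht i k).trans (le_max_left _ _)
  -- the closeness target, the Grönwall constant and `δ`
  set ηc : ℝ := min 1 (A / 4) with hηc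
  have hηc0 : 0 < ηc := by rw [hηc]; positivity
  have hηc1 : ηc ≤ 1 := min_le_left _ _
  have hηcA : ηc ≤ A / 4 := min_le_right _ _
  set Cg : ℝ := 2 ^ (⌈(t₁ + 1) * (16 * ((4 : ℕ) : ℝ) ^ 2 * 1 * (1 + ε₀) ^ (10 : ℝ) * (M + 2) + 1)⌉₊ + 1) * M with hCg
  have hCg0 : 0 ≤ Cg := by rw [hCg]; positivity
  set δ : ℝ := min (ν / 2) (ηc / (Cg + 1)) with hδ
  have hδ0 : 0 < δ := by rw [hδ]; positivity
  refine ⟨δ, hδ0, fun ν' hν' hνν' => ?_⟩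
  have hν'ν : ν / 2 ≤ ν' := by
    have := (abs_lt.1 (hνν'.trans_le (min_le_left _ _))).1
    linarith only [this]
  have hsmall : Cg * |ν' - ν| ≤ ηc := by
    have h1 : |ν' - ν| ≤ ηc / (Cg + 1) := (hνν'.trans_le (min_le_right _ _)).le
    calc Cg * |ν' - ν| ≤ Cg * (ηc / (Cg + 1)) := mul_le_mul_of_nonneg_left h1 hCg0
      _ = ηc * (Cg / (Cg + 1)) := by ring
      _ ≤ ηc * 1 := by
          refine mul_le_mul_of_nonneg_left ?_ hηc0.le
          rw [div_le_one (by positivity)]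
          linarith
      _ = ηc := mul_one _
  have hν'A : 32 * ((4 : ℕ) : ℝ) ^ 2 * 1 * (1 + ε₀) ^ (2 : ℝ) * A ≤ ν' := by rw [hAν]; exact hν'ν
  -- derivatives of `X` within `[0, ∞)`, restricted table
  have hderX : ∀ (i : Fin 4) (k : ℤ), ∀ t ∈ Ici (0 : ℝ), HasDerivWithinAt (X i k)
      (quadTerm ε₀ (restrictShiftSet α) X i k t - ν * (1 + ε₀) ^ ((2 : ℝ) * k) * X i k t) (Ici 0) t := by
    intro i k t ht
    have h := ((hX.contDiffOn i k).differentiableOn one_ne_zero t ht).hasDerivWithinAt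
    rw [hX.motion i k t ht, ← quadTerm_restrictShiftSet] at h
    exact h
  -- the envelope amplitude
  set Aenv : ℝ := max (M + 1) A with hAenv
  refine exists_viscousGlobal_of_subcriticalEnvelope_of_inTableClass hε.le one_pos hν' hα X₀ (η := 1) fun T _hT => ?_
  refine ⟨((4 : ℕ) : ℝ) / 2 * Aenv ^ 2 / (1 - ((1 + ε₀) ^ (2 : ℕ))⁻¹),
    fun s hs X' hinit hlow hreg hcont hder n N _hnN t ht => ?_⟩
  -- derivatives of `X'` with the restricted table
  have hder' : ∀ i k, ∀ τ ∈ Icc 0 s, HasDerivWithinAt (X' i k)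
      (quadTerm ε₀ (restrictShiftSet α) X' i k τ - ν' * (1 + ε₀) ^ ((2 : ℝ) * k) * X' i k τ) (Icc 0 s) τ := by
    intro i k τ hτ
    rw [quadTerm_restrictShiftSet]
    exact hder i k τ hτ
  -- (E2) continuity on `[0, s₁]`, `s₁ = min s t₁`
  set s₁ : ℝ := min s t₁ with hs₁
  have hs₁t : s₁ ≤ t₁ := min_le_right _ _
  have hs₁s : s₁ ≤ s := min_le_left _ _
  have hD : ∀ τ ∈ Icc 0 s₁, ∀ (i : Fin 4) (k : ℤ),
      (1 + ε₀) ^ ((8 : ℝ) * ((max k 0 : ℤ) : ℝ)) * |X' i k τ - X i k τ| ≤ ηc := by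
    obtain ⟨M', hM'⟩ := hreg
    refine weighted_continuity (m := 4) (S := t₁ + 1) hε zero_le_one hα' hν'.le hM0 hηc0 hηc1 (by linarith)
      (fun i k => by rw [hX.init, hinit])
      (fun i k hk τ hτ => hX.noLow i k τ hk hτ.1) (fun i k hk τ _ => hlow i k hk τ)
      (fun τ hτ i k => hM τ ⟨hτ.1, hτ.2.trans (by linarith)⟩ i k)
      ⟨M', fun τ _ i k => hM' τ i k⟩ (fun i k τ hτ => (hderX i k τ hτ.1).mono fun u hu => hu.1)
      (fun i k τ hτ => (hder' i k τ ⟨hτ.1, hτ.2.trans hs₁s⟩).mono (Icc_subset_Icc_right hs₁s)) ?_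
    exact hsmall
  -- envelope `(M+1)λ^{-k}` on `[0, s₁]`
  have henv1 : ∀ τ ∈ Icc 0 s₁, ∀ (i : Fin 4) (k : ℤ), |X' i k τ| ≤ (M + 1) * (1 + ε₀) ^ (-(k : ℝ)) := by
    intro τ hτ i k
    rcases lt_or_ge k 0 with hk | hk
    · rw [hlow i k hk τ, abs_zero]; exact mul_nonneg (by linarith) (hpow _).le
    · have hk' : (0 : ℝ) ≤ k := by exact_mod_cast hk
      have h1 := hM τ ⟨hτ.1, hτ.2.trans (by linarith)⟩ i k
      have h2 := hD τ hτ i k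
      rw [max_eq_left hk] at h2
      have e10 : 1 ≤ (1 + ε₀) ^ (-(k : ℝ)) * (1 + ε₀) ^ ((10 : ℝ) * k) := by
        rw [← Real.rpow_add hl0]; exact Real.one_le_rpow hl1.le (by nlinarith)
      have e8 : 1 ≤ (1 + ε₀) ^ (-(k : ℝ)) * (1 + ε₀) ^ ((8 : ℝ) * k) := by
        rw [← Real.rpow_add hl0]; exact Real.one_le_rpow hl1.le (by nlinarith)
      have hX10 : (1 + ε₀) ^ ((10 : ℝ) * k) * |X i k τ| ≤ M := by
        linarith only [h1, abs_nonneg (X i k τ)]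
      have hX1 : |X i k τ| ≤ M * (1 + ε₀) ^ (-(k : ℝ)) := by
        have p1 := mul_nonneg (sub_nonneg.2 e10) (abs_nonneg (X i k τ))
        have p2 := mul_nonneg (sub_nonneg.2 hX10) (hpow (-(k : ℝ))).le
        linarith only [p1, p2]
      have hD1 : |X' i k τ - X i k τ| ≤ 1 * (1 + ε₀) ^ (-(k : ℝ)) := by
        have p1 := mul_nonneg (sub_nonneg.2 e8) (abs_nonneg (X' i k τ - X i k τ))
        have p2 := mul_nonneg (sub_nonneg.2 h2) (hpow (-(k : ℝ))).le
        have p3 := mul_nonneg (sub_nonneg.2 hηc1) (hpow (-(k : ℝ))).le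
        linarith only [p1, p2, p3]
      have htri : |X' i k τ| ≤ |X i k τ| + |X' i k τ - X i k τ| := by
        have := abs_add_le (X i k τ) (X' i k τ - X i k τ); rwa [add_sub_cancel] at this
      linarith only [htri, hX1, hD1]
  -- the envelope `Aenv λ^{-k}` at the time `t`
  have henv : ∀ (i : Fin 4) (k : ℤ), |X' i k t| ≤ Aenv * (1 + ε₀) ^ (-(k : ℝ)) := by
    intro i k
    rcases le_or_gt t t₁ with htt | htt
    · have hts : t ∈ Icc 0 s₁ := ⟨ht.1, le_min ht.2 htt⟩
      exact (henv1 t hts i k).trans (mul_le_mul_of_nonneg_right (le_max_left _ _) (hpow _).le)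
    · -- (E3) restart from `t₁`: here `s₁ = t₁`
      have hs₁eq : s₁ = t₁ := min_eq_right (htt.le.trans ht.2)
      have ht₁s₁ : t₁ ∈ Icc 0 s₁ := ⟨ht₁, by rw [hs₁eq]⟩
      have h1 : ∀ (i : Fin 4) (k : ℤ), |X' i k t₁| ≤ A / 2 * (1 + ε₀) ^ (-(k : ℝ)) := by
        intro i k
        rcases lt_or_ge k 0 with hk | hk
        · rw [hlow i k hk t₁, abs_zero]; exact mul_nonneg (by positivity) (hpow _).le
        · obtain ⟨n, rfl⟩ := Int.eq_ofNat_of_zero_le hk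
          have hP : (0 : ℝ) < (1 + ε₀) ^ n := pow_pos hl0 n
          have hXn := hθ i n
          have hDn := hD t₁ ht₁s₁ i n
          have h8 : (1 + ε₀) ^ n ≤ (1 + ε₀) ^ ((8 : ℝ) * ((max (n : ℤ) 0 : ℤ) : ℝ)) := by
            rw [max_eq_left (by positivity : (0 : ℤ) ≤ n)]
            push_cast
            rw [← Real.rpow_natCast]
            exact Real.rpow_le_rpow_of_exponent_le hl1.le (by have : (0 : ℝ) ≤ n := Nat.cast_nonneg n; linarith)
          have hDn' : (1 + ε₀) ^ n * |X' i n t₁ - X i n t₁| ≤ ηc :=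
            (mul_le_mul_of_nonneg_right h8 (abs_nonneg _)).trans hDn
          have htri : |X' i (n : ℤ) t₁| ≤ |X i n t₁| + |X' i n t₁ - X i n t₁| := by
            have := abs_add_le (X i n t₁) (X' i n t₁ - X i n t₁); rwa [add_sub_cancel] at this
          have e1 : (1 + ε₀) ^ (-(((n : ℕ) : ℤ) : ℝ)) = ((1 + ε₀) ^ n)⁻¹ := by
            rw [Int.cast_natCast, Real.rpow_neg hl0.le, Real.rpow_natCast]
          rw [e1, ← div_eq_mul_inv, le_div_iff₀ hP]
          have p := mul_le_mul_of_nonneg_right htri hP.le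
          linarith only [p, hXn, hDn', hηcA]
      exact (envelope_from_time (m := 4) hε zero_le_one hA0 hα' hν' hν'A ht₁ h1 hlow hreg hcont hder'
        t ⟨htt.le, ht.2⟩ i k).trans (mul_le_mul_of_nonneg_right (le_max_right _ _) (hpow _).le)
  exact tailEnergy_le_of_envelope hε henv n N

/-- Alias under the skeleton's stub name (LINE g11-1 v2.2/v2.3 `stub_regularOpen`). [folklore] -/
theorem stub_regularOpen : ∀ ε₀ : ℝ, 0 < ε₀ → ∀ R : ℝ, 1 ≤ R →
    ∀ (α : Fin 4 → Fin 4 → Fin 4 → ℤ × ℤ × ℤ → ℝ) (X₀ : Fin 4 → ℝ),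
    Literature.Analysis.FluidPDE.TaoCascade.InTableClass R α →
    ∀ ν : ℝ, 0 < ν →
    (∃ X : Fin 4 → ℤ → ℝ → ℝ, Literature.Analysis.FluidPDE.TaoCascade.ViscousGlobal ε₀ ν α X₀ X) →
    ∃ δ : ℝ, 0 < δ ∧ ∀ ν' : ℝ, 0 < ν' → |ν' - ν| < δ →
      ∃ X' : Fin 4 → ℤ → ℝ → ℝ, Literature.Analysis.FluidPDE.TaoCascade.ViscousGlobal ε₀ ν' α X₀ X' :=
  regularOpen

end Summit.NavierStokesRegularity.NavierStokesRegularity.Theorems.MinimalViscousBlowup.ThresholdRay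

end
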